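import Summits.AtomisticToContinuum.BoseEinsteinCondensation.Theorems.BECThomsonPrincipleGDTransferLnssAlgebra
import Summits.AtomisticToContinuum.BoseEinsteinCondensation.Theorems.BECThomsonPrincipleGDTransferChordVariationForms
import Summits.AtomisticToContinuum.BoseEinsteinCondensation.Theorems.BECThomsonPrincipleGDTransferSeededDefs

/-!
# Route `BECThomsonPrinciple`, crux `GDTransfer` (stmt-AtomisticToContinuum-9482), line `seeded-continuity`:
# stub `stub_projectedDichotomy`, part A — the PLAIN one-body witness pair `N^{-1/2}a_n†a_0Ψ`, `N^{-1/2}a_0†a_nΨ`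

Support file of the registered stub `stub_projectedDichotomy` (`GaussianDominationCan → ∀ v soft, BandEmptiness v`).
The witness pair tested against the two-sided dual-norm bound (`TwoSidedDualNorm`, landed `stub_chordVariation`) is the
PLAIN one-body pair, in first quantisation
`B_n g = a_n†a_0 g = Σ_i e_n(x_i)·P_i g` (`cellWave`, `Negative.cellAvg`) and `B_n† g = a_0†a_n g = Σ_i P_i^{(n)} g`
(`fourierAvg`), normalised by `N^{-1/2}` — no inverse root `n̂₀^{-1/2}`, hence no `[V, n̂₀^{-1/2}]` anomaly in its second
variation; the price `√(n̂₀/N)` is paid in the overlap and is affordable for BAND emptiness, which only needs the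
`n̂₀`-weighted law.  Here:
* (A1) both are variation DIRECTIONS for every direction `g` (`isDirection_upB`, `isDirection_dnB`): `C¹`, periodic, and
  Bose-symmetric by relabelling the slot sum (`cellAvg_comp_perm_of_symm`, `sum_fourierAvg_comp_perm`);
* (A4) the WEIGHTED OCCUPATION is below the occupation, `‖N^{-1/2}B_n†Ψ‖² ≤ n_n(Ψ)` (`mass_dnB_le_cellOccupation`):
  Cauchy–Schwarz on the slot sum and `Σ_i ∫|P_i^{(n)}Ψ|² = N∫|P_0^{(n)}Ψ|² = ‖Λ_nΨ‖² = n_n(Ψ)` (Bose symmetry and (L3) of the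
  landed `LNSSAlgebra`, `Lnss.integral_norm_sq_lnssLower`, `Lnss.mass_lnssLower`);
* (C3) MARKOV on the law for the second-moment count: on the band `θN ≤ |S| < (1−β)N` one has
  `(|S|+1)(N−|S|) ≥ θβN²`, so `θβN² · bandMass ≤ Σ_S (|S|+1)(N−|S|) w_S` (`ofReal_mul_bandMass_le_secondMoment`).
All [folklore] (KennedyLiebShastry1988; arXiv:1211.2778 §2; LSSY2005 App. A).
-/

noncomputable section

open MeasureTheory Filter
open scoped ENNReal NNReal ComplexConjugate

namespace Summit.AtomisticToContinuum.BoseEinsteinCondensation.Cruxes.GDTransfer.Seeded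

namespace PlainPair

open Literature.MathematicalPhysics.QuantumManyBody.BoseGas
open Summit.AtomisticToContinuum.BoseEinsteinCondensation.Theorems.GaussianDominationCan.Negative
open Summit.AtomisticToContinuum.BoseEinsteinCondensation.Cruxes.GDTransfer.DysonDressedWitness
open ChordVariation (dir_const_mul mass_smul)
open Lnss

variable {m : ℕ} {L : ℝ}

/-! ## (A1) The plain pair consists of directions -/

/-- **`B_n g = Σ_i e_n(x_i) P_i g` is a direction** for every direction `g` (`L ≠ 0`). [folklore] -/
theorem isDirection_upB (hL : L ≠ 0) (n : Fin 3 → ℤ) {g : Config (m + 1) → ℂ} (hg : IsDirection m L g) :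
    IsDirection m L (fun X => ∑ i : Fin (m + 1), cellWave L n (X i) * cellAvg (m + 1) L i g X) := by
  refine ⟨ContDiff.sum fun i _ => (((contDiff_cellWave L n).of_le (mod_cast le_top)).comp
      (contDiff_apply ℝ Space i)).mul (contDiff_cellAvg i hg.contDiff), fun X j k => ?_, fun σ X => ?_⟩
  · refine Finset.sum_congr rfl fun i _ => ?_
    rw [cellAvg_periodic i hg.periodic X j k, Pi.add_apply]
    rcases eq_or_ne i j with rfl | hij
    · rw [Pi.single_eq_same, cellWave_periodic hL]
    · rw [Pi.single_eq_of_ne hij, add_zero]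
  · simp only [Function.comp_apply, cellAvg_comp_perm_of_symm σ _ hg.symm]
    exact Equiv.sum_comp σ (fun j => cellWave L n (X j) * cellAvg (m + 1) L j g X)

/-- **`B_n† g = Σ_i P_i^{(n)} g` is a direction** for every direction `g`. [folklore] -/
theorem isDirection_dnB (n : Fin 3 → ℤ) {g : Config (m + 1) → ℂ} (hg : IsDirection m L g) :
    IsDirection m L (fun X => ∑ i : Fin (m + 1), fourierAvg m L n i g X) :=
  ⟨ContDiff.sum fun i _ => contDiff_fourierAvg n i hg.contDiff,
    fun X j k => Finset.sum_congr rfl fun i _ => fourierAvg_periodic n i hg.periodic X j k,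
    fun σ X => sum_fourierAvg_comp_perm n hg.symm σ X⟩

/-! ## (A4) The weighted occupation is below the occupation -/

/-- Every slot carries the same `P^{(n)}`-mass for Bose-symmetric `ψ`: `∫|P_i^{(n)}ψ|² = ∫|P_0^{(n)}ψ|²`. [folklore] -/
theorem integral_norm_sq_fourierAvg_eq_zero_slot (n : Fin 3 → ℤ) (i : Fin (m + 1)) {ψ : Config (m + 1) → ℂ}
    (hψs : ∀ (σ : Equiv.Perm (Fin (m + 1))) (X : Config (m + 1)), ψ (X ∘ σ) = ψ X) :
    ∫ X in cellN (m + 1) L, ‖fourierAvg m L n i ψ X‖ ^ 2 =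
      ∫ X in cellN (m + 1) L, ‖fourierAvg m L n 0 ψ X‖ ^ 2 := by
  -- adapted from step `e4` of `Lnss.integral_norm_sq_lnssLower`
  rw [← setIntegral_cellN_comp_perm (Equiv.swap 0 i) (fun X => ‖fourierAvg m L n 0 ψ X‖ ^ 2)]
  refine integral_congr_ae (Eventually.of_forall fun X => ?_)
  simp only [fourierAvg_comp_perm_of_symm n _ 0 hψs, Equiv.swap_apply_left]

/-- **Cauchy–Schwarz on the slot sum**: `∫|Σ_i P_i^{(n)}ψ|² ≤ N · Σ_i ∫|P_i^{(n)}ψ|²`. [folklore] -/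
theorem integral_norm_sq_dnB_le (n : Fin 3 → ℤ) {ψ : Config (m + 1) → ℂ} (hψ : Continuous ψ) :
    ∫ X in cellN (m + 1) L, ‖∑ i : Fin (m + 1), fourierAvg m L n i ψ X‖ ^ 2 ≤
      (m + 1 : ℝ) * ∑ i : Fin (m + 1), ∫ X in cellN (m + 1) L, ‖fourierAvg m L n i ψ X‖ ^ 2 := by
  have hc : ∀ i, Continuous (fourierAvg m L n i ψ) := fun i => continuous_fourierAvg n i hψ
  have hint : ∀ i ∈ (Finset.univ : Finset (Fin (m + 1))),
      Integrable (fun X => ‖fourierAvg m L n i ψ X‖ ^ 2)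
        ((volume : Measure (Config (m + 1))).restrict (cellN (m + 1) L)) := fun i _ =>
    integrableOn_cellN ((hc i).norm.pow 2) L
  have hint' : Integrable (fun X => ∑ i : Fin (m + 1), ‖fourierAvg m L n i ψ X‖ ^ 2)
      ((volume : Measure (Config (m + 1))).restrict (cellN (m + 1) L)) :=
    integrableOn_cellN (continuous_finsetSum _ fun i _ => (hc i).norm.pow 2) L
  rw [← integral_finsetSum _ hint, ← integral_const_mul]
  refine integral_mono_of_nonneg (Eventually.of_forall fun X => sq_nonneg _) (hint'.const_mul _)
    (Eventually.of_forall fun X => ?_)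
  calc ‖∑ i : Fin (m + 1), fourierAvg m L n i ψ X‖ ^ 2
      ≤ (∑ i : Fin (m + 1), ‖fourierAvg m L n i ψ X‖) ^ 2 := by
        gcongr
        exact norm_sum_le _ _
    _ ≤ (Finset.univ : Finset (Fin (m + 1))).card * ∑ i : Fin (m + 1), ‖fourierAvg m L n i ψ X‖ ^ 2 :=
        sq_sum_le_card_mul_sum_sq
    _ = (m + 1 : ℝ) * ∑ i : Fin (m + 1), ‖fourierAvg m L n i ψ X‖ ^ 2 := by
        rw [Finset.card_univ, Fintype.card_fin, Nat.cast_add, Nat.cast_one]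

/-- **(A4) The weighted occupation is below the occupation**: `‖N^{-1/2} B_n†Ψ‖² ≤ n_n(Ψ)` for a periodic trial state
(Cauchy–Schwarz on the slot sum, Bose symmetry, and `N∫|P_0^{(n)}Ψ|² = ‖Λ_nΨ‖² = n_n(Ψ)`). [folklore] -/
theorem mass_dnB_le_cellOccupation (hL : 0 < L) (n : Fin 3 → ℤ) (Ψ : PeriodicTrialState (m + 1) L) :
    mass L (fun X => ((Real.sqrt ((m : ℝ) + 1))⁻¹ : ℂ) * ∑ i : Fin (m + 1), fourierAvg m L n i Ψ.ψ X) ≤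
      cellOccupation (m + 1) L (planeWaveMode L n) Ψ.ψ := by
  have hψ : Continuous Ψ.ψ := Ψ.contDiff.continuous
  have hc : ∀ i, Continuous (fourierAvg m L n i Ψ.ψ) := fun i => continuous_fourierAvg n i hψ
  have hN : (0 : ℝ) < (m : ℝ) + 1 := by positivity
  -- the scalar
  have hcoef : ((‖((Real.sqrt ((m : ℝ) + 1))⁻¹ : ℂ)‖₊ : ℝ≥0∞)) ^ 2 = ENNReal.ofReal (((m : ℝ) + 1)⁻¹) := by
    rw [← ENNReal.coe_pow, ← ENNReal.ofReal_coe_nnreal, NNReal.coe_pow, coe_nnnorm, norm_inv, Complex.norm_real,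
      Real.norm_of_nonneg (Real.sqrt_nonneg _), inv_pow, Real.sq_sqrt hN.le]
  -- the unnormalised mass in real numbers
  have hreal : ∫ X in cellN (m + 1) L, ‖∑ i : Fin (m + 1), fourierAvg m L n i Ψ.ψ X‖ ^ 2 ≤
      ((m : ℝ) + 1) * ∫ X in cellN (m + 1) L, ‖lnssLower m L n Ψ.ψ X‖ ^ 2 := by
    calc ∫ X in cellN (m + 1) L, ‖∑ i : Fin (m + 1), fourierAvg m L n i Ψ.ψ X‖ ^ 2
        ≤ (m + 1 : ℝ) * ∑ i : Fin (m + 1), ∫ X in cellN (m + 1) L, ‖fourierAvg m L n i Ψ.ψ X‖ ^ 2 :=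
          integral_norm_sq_dnB_le n hψ
      _ = (m + 1 : ℝ) * ((m + 1 : ℝ) * ∫ X in cellN (m + 1) L, ‖fourierAvg m L n 0 Ψ.ψ X‖ ^ 2) := by
          rw [Finset.sum_congr rfl fun i _ => integral_norm_sq_fourierAvg_eq_zero_slot n i Ψ.symm,
            Finset.sum_const, Finset.card_univ, Fintype.card_fin, nsmul_eq_mul, Nat.cast_add, Nat.cast_one]
      _ = ((m : ℝ) + 1) * ∫ X in cellN (m + 1) L, ‖lnssLower m L n Ψ.ψ X‖ ^ 2 := by
          rw [integral_norm_sq_lnssLower hL n hψ Ψ.symm]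
  -- back to `ℝ≥0∞`
  have hI0 : 0 ≤ ∫ X in cellN (m + 1) L, ‖lnssLower m L n Ψ.ψ X‖ ^ 2 := integral_nonneg fun X => sq_nonneg _
  rw [mass_smul, hcoef, ← mass_lnssLower hL n hψ Ψ.symm]
  unfold mass
  rw [lintegral_nnnorm_sq_eq _ (continuous_finsetSum _ fun i _ => hc i),
    lintegral_nnnorm_sq_eq _ (continuous_lnssLower n hψ), ← ENNReal.ofReal_mul (inv_nonneg.2 hN.le)]
  refine ENNReal.ofReal_le_ofReal ?_
  calc ((m : ℝ) + 1)⁻¹ * ∫ X in cellN (m + 1) L, ‖∑ i : Fin (m + 1), fourierAvg m L n i Ψ.ψ X‖ ^ 2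
      ≤ ((m : ℝ) + 1)⁻¹ * (((m : ℝ) + 1) * ∫ X in cellN (m + 1) L, ‖lnssLower m L n Ψ.ψ X‖ ^ 2) :=
        mul_le_mul_of_nonneg_left hreal (inv_nonneg.2 hN.le)
    _ = ∫ X in cellN (m + 1) L, ‖lnssLower m L n Ψ.ψ X‖ ^ 2 := by
        rw [← mul_assoc, inv_mul_cancel₀ hN.ne', one_mul]

/-! ## (C3) Markov on the law for the second-moment count -/

/-- **(C3) Markov**: `θβN² · P(θN ≤ n̂₀ < (1−β)N) ≤ Σ_S (|S|+1)(N−|S|) w_S` (on the band `|S| + 1 ≥ θN` and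
`N − |S| > βN`; `β > 0`, any real `θ`). [folklore] -/
theorem ofReal_mul_bandMass_le_secondMoment (L θ : ℝ) {β : ℝ} (hβ : 0 < β) (ψ : Config (m + 1) → ℂ) :
    ENNReal.ofReal (θ * β * (m + 1) ^ 2) * bandMass m L θ β ψ ≤
      ∑ S : Finset (Fin (m + 1)), (((S.card + 1) * (m + 1 - S.card) : ℕ) : ℝ≥0∞) * compMass m L S ψ := by
  unfold bandMass lawMass
  rw [Finset.mul_sum]
  calc ∑ S ∈ (Finset.univ : Finset (Finset (Fin (m + 1)))).filter
          (fun S => θ * (m + 1) ≤ (S.card : ℝ) ∧ (S.card : ℝ) < (1 - β) * (m + 1)),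
          ENNReal.ofReal (θ * β * (m + 1) ^ 2) * compMass m L S ψ
      ≤ ∑ S ∈ (Finset.univ : Finset (Finset (Fin (m + 1)))).filter
          (fun S => θ * (m + 1) ≤ (S.card : ℝ) ∧ (S.card : ℝ) < (1 - β) * (m + 1)),
          (((S.card + 1) * (m + 1 - S.card) : ℕ) : ℝ≥0∞) * compMass m L S ψ := by
        refine Finset.sum_le_sum fun S hS => ?_
        obtain ⟨h1, h2⟩ := (Finset.mem_filter.1 hS).2
        have hcard : S.card ≤ m + 1 := by
          simpa only [Fintype.card_fin] using S.card_le_univ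
        have ha : θ * (m + 1) ≤ (S.card : ℝ) + 1 := by linarith
        have hb : β * (m + 1) ≤ ((m + 1 - S.card : ℕ) : ℝ) := by
          rw [Nat.cast_sub hcard]
          push_cast
          linarith
        have hle : θ * β * (m + 1) ^ 2 ≤ (((S.card + 1) * (m + 1 - S.card) : ℕ) : ℝ) := by
          rw [Nat.cast_mul]
          calc θ * β * (m + 1) ^ 2 = (θ * (m + 1)) * (β * (m + 1)) := by ring
            _ ≤ ((S.card : ℝ) + 1) * ((m + 1 - S.card : ℕ) : ℝ) :=
                mul_le_mul ha hb (by positivity) (by positivity)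
            _ = ((S.card + 1 : ℕ) : ℝ) * ((m + 1 - S.card : ℕ) : ℝ) := by push_cast; ring
        have hle' : ENNReal.ofReal (θ * β * (m + 1) ^ 2) ≤ (((S.card + 1) * (m + 1 - S.card) : ℕ) : ℝ≥0∞) :=
          (ENNReal.ofReal_le_ofReal hle).trans_eq (ENNReal.ofReal_natCast _)
        exact mul_le_mul' hle' le_rfl
    _ ≤ ∑ S : Finset (Fin (m + 1)), (((S.card + 1) * (m + 1 - S.card) : ℕ) : ℝ≥0∞) * compMass m L S ψ :=
        Finset.sum_le_sum_of_subset_of_nonneg (Finset.filter_subset _ _) fun _ _ _ => zero_le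

end PlainPair

/-- **Part A of `stub_projectedDichotomy` (registered helper statement)**: the weighted occupation carried by the plain
witness `N^{-1/2} a_0†a_n Ψ = N^{-1/2} Σ_i P_i^{(n)} Ψ` is below the plane-wave occupation `n_n(Ψ)`, for every periodic
trial state. [folklore] -/
theorem plainPair_mass_dnB_le_cellOccupation :
    ∀ (m : ℕ) (L : ℝ), 0 < L → ∀ (n : Fin 3 → ℤ)
      (Ψ : Literature.MathematicalPhysics.QuantumManyBody.BoseGas.PeriodicTrialState (m + 1) L),
      Summit.AtomisticToContinuum.BoseEinsteinCondensation.Cruxes.GDTransfer.DysonDressedWitness.mass L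
          (fun X => ((Real.sqrt ((m : ℝ) + 1))⁻¹ : ℂ) *
            ∑ i : Fin (m + 1),
              Summit.AtomisticToContinuum.BoseEinsteinCondensation.Cruxes.GDTransfer.DysonDressedWitness.fourierAvg
                m L n i Ψ.ψ X) ≤
        Literature.MathematicalPhysics.QuantumManyBody.BoseGas.cellOccupation (m + 1) L
          (Literature.MathematicalPhysics.QuantumManyBody.BoseGas.planeWaveMode L n) Ψ.ψ :=
  fun _ _ hL n Ψ => PlainPair.mass_dnB_le_cellOccupation hL n Ψ

end Summit.AtomisticToContinuum.BoseEinsteinCondensation.Cruxes.GDTransfer.Seeded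

end
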